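import Literature.Combinatorics.SimpleGraph.LovaszTheta
import Literature.Combinatorics.SimpleGraph.LasserreStableBound
import Mathlib.Algebra.Order.BigOperators.Ring.Finset
import HarnessLib

/-!
# Level one of Lasserre's hierarchy is the Lovász number: `las⁽¹⁾(G) = ϑ(G)`

Laurent (2006, p. 248): "For `k = 1`, `las⁽¹⁾(G) = ϑ(G)`, the Lovász' theta number", where
Laurent's `ϑ(G)` is the program (1), p. 240,
`max Σ_i X_ii s.t. X = (X_ij)_{i,j ∈ V ∪ {0}} ⪰ 0, X_00 = 1, X_0i = X_ii, X_ij = 0 (ij ∈ E)` —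
literally the level-1 moment program, `X = M_1(y)`. The tree's
`Literature.Combinatorics.SimpleGraph.lovaszTheta` is the OTHER standard semidefinite form
`ϑ(G) = max {Σ_{u,v} B_uv : B ⪰ 0, Tr B = 1, B_uv = 0 (uv ∈ E)}` (Lovász 1979; Knuth 1994, `ϑ₃`;
Grötschel–Lovász–Schrijver). This file PROVES that the two maximisation programs have the same
value, by explicit value-non-decreasing maps between the two feasible regions (no duality needed):

* `IsLasserreFeasible.sum_singleton_le_lovaszTheta` (`las⁽¹⁾ ≤ ϑ`): from a level-1 feasible `y`
  with value `s = Σ_v y_v > 0` the matrix `B_uv := y_{uv} / s` is theta-feasible, and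
  `Σ_{u,v} B_uv = s⁻¹ Σ_{u,v} y_{uv} ≥ s` because `M_1(y) ⪰ 0` tested at the vector
  `(−s, 1, …, 1)` gives `Σ_{u,v} y_{uv} ≥ s²` (`IsLasserreFeasible.sq_sum_le_sum_sum_pair`).
* `IsThetaFeasible.entrySum_le_lasserreStableBound_one` (`ϑ ≤ las⁽¹⁾`): from a theta-feasible
  `B` with `s = Σ_{u,v} B_uv > 0`, row sums `b_v = Σ_w B_vw` and scalings `d_v = b_v / B_vv`
  (`0` if `B_vv = 0`, in which case `b_v = 0`), the moments `y_∅ = 1`, `y_v = b_v² / (s B_vv)`,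
  `y_{uv} = d_u d_v B_uv / s` are level-1 feasible: `M_1(y) = Rᵀ (s⁻¹ B) R` for the `V × P_1(V)`
  matrix `R` with columns `R_∅ = 𝟙`, `R_{v} = d_v e_v` (`momentMatrix_thetaToMoments`), and the
  value is `s⁻¹ Σ_v b_v² / B_vv ≥ s⁻¹ (Σ_v b_v)² / (Σ_v B_vv) = s` by Cauchy–Schwarz and `Tr B = 1`.
  (In Gram language: `B = (w_u · w_v)`, `e = Σ w_v / ‖Σ w_v‖`, `y_v = (e · w_v)² / ‖w_v‖²` — the
  passage between Knuth's `ϑ₃` and the orthogonal-labelling value; Knuth 1994, §§6–7.)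
* `lasserreStableBound_one_eq_lovaszTheta` — the equality.

## References

* M. Laurent, *Strengthened semidefinite programming bounds for codes*, Math. Program. 109 (2007)
  239–261, program (1) p. 240 and p. 248 [Laurent2006].
* D. E. Knuth, *The Sandwich Theorem*, Electron. J. Combin. 1 (1994), A1, §§6–7 [Knuth1994].
* L. Lovász, *On the Shannon capacity of a graph*, IEEE Trans. Inform. Theory 25 (1979) 1–7
  [Lovasz1979].
-/

namespace Literature.Combinatorics.SimpleGraph

open Matrix Finset

variable {V : Type*} [Fintype V] [DecidableEq V]

/-! ### The index set `P_1(V) = {∅} ∪ {{v} : v ∈ V}` -/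

/-- The index map `Option V → P_1(V)`, `none ↦ ∅`, `some v ↦ {v}`. [folklore] -/
def levelOneIndex (o : Option V) : {S : Finset V // S.card ≤ 1} :=
  o.elim ⟨∅, by simp⟩ fun v => ⟨{v}, by simp⟩

omit [Fintype V] [DecidableEq V] in
/-- `levelOneIndex none = ∅`. [folklore] -/
@[simp] theorem levelOneIndex_none_val : (levelOneIndex (V := V) none).1 = ∅ := rfl

omit [Fintype V] [DecidableEq V] in
/-- `levelOneIndex (some v) = {v}`. [folklore] -/
@[simp] theorem levelOneIndex_some_val (v : V) : (levelOneIndex (some v)).1 = {v} := rfl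

omit [Fintype V] [DecidableEq V] in
/-- Every element of `P_1(V)` is `∅` or a singleton. [folklore] -/
theorem levelOne_cases (I : {S : Finset V // S.card ≤ 1}) : I.1 = ∅ ∨ ∃ u, I.1 = {u} := by
  rcases Nat.le_one_iff_eq_zero_or_eq_one.1 I.2 with h | h
  · exact Or.inl (card_eq_zero.1 h)
  · exact Or.inr (card_eq_one.1 h)

/-! ### `las⁽¹⁾(G) ≤ ϑ(G)` -/

namespace IsLasserreFeasible

variable {G : SimpleGraph V} {y : Finset V → ℝ}

/-- `M_1(y) ⪰ 0` tested at `(−s, 1, …, 1)`, `s = Σ_v y_v`: `s² ≤ Σ_{u,v} y_{uv}` (the Schur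
complement inequality `𝟙ᵀ Y 𝟙 ≥ (𝟙ᵀ y)²` for `[[1, yᵀ], [y, Y]] ⪰ 0`). [folklore] -/
theorem sq_sum_le_sum_sum_pair (hy : IsLasserreFeasible G 1 y) :
    (∑ v, y {v}) ^ 2 ≤ ∑ u, ∑ v, y {u, v} := by
  set s := ∑ v, y {v} with hs
  have hpsd := hy.posSemidef.submatrix (levelOneIndex (V := V))
  have h := hpsd.dotProduct_mulVec_nonneg (fun o => o.elim (-s) fun _ => 1)
  rw [star_trivial] at h
  have hexp : (fun o : Option V => o.elim (-s) fun _ => (1 : ℝ)) ⬝ᵥ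
      ((momentMatrix 1 y).submatrix levelOneIndex levelOneIndex *ᵥ
        fun o : Option V => o.elim (-s) fun _ => 1) =
      s * s * y ∅ - s * (∑ v, y {v}) - s * (∑ u, y {u}) + ∑ u, ∑ v, y {u, v} := by
    simp only [dotProduct, mulVec, Fintype.sum_option, submatrix_apply, momentMatrix_apply,
      levelOneIndex_none_val, levelOneIndex_some_val, Option.elim_none, Option.elim_some,
      empty_union, union_empty, ← insert_eq, mul_one, one_mul, mul_neg, neg_mul,
      Finset.sum_neg_distrib, Finset.sum_add_distrib, ← Finset.sum_mul]
    ring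
  rw [hexp, hy.empty_eq_one, ← hs] at h
  nlinarith [h]

/-- **`las⁽¹⁾(G) ≤ ϑ(G)`, pointwise**: the value of every level-1 feasible `y` is at most `ϑ(G)`
(for `s = Σ_v y_v > 0`, `B := (y_{uv} / s)_{u,v}` is theta-feasible with `Σ B ≥ s`).
[cite: Laurent2006, §3.1, p. 248] -/
theorem sum_singleton_le_lovaszTheta (hy : IsLasserreFeasible G 1 y) :
    ∑ v, y {v} ≤ lovaszTheta G := by
  set s := ∑ v, y {v} with hs
  rcases le_or_gt s 0 with hs0 | hs0
  · exact hs0.trans (lovaszTheta_nonneg G)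
  · set B : Matrix V V ℝ := Matrix.of fun u v => s⁻¹ * y {u, v} with hB
    -- `B` is a positive multiple of the principal submatrix of `M_1(y)` on singletons
    have hBsub : B = s⁻¹ • (momentMatrix 1 y).submatrix (fun v => levelOneIndex (some v))
        (fun v => levelOneIndex (some v)) := by
      ext u v
      simp [hB]
    have hfeas : IsThetaFeasible G B := by
      refine ⟨?_, ?_, fun u v huv => ?_⟩
      · rw [hBsub]
        exact (hy.posSemidef.submatrix _).smul (inv_nonneg.2 hs0.le)
      · simp only [Matrix.trace, Matrix.diag, hB, of_apply, pair_eq_singleton]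
        rw [← mul_sum, ← hs, inv_mul_cancel₀ hs0.ne']
      · simp [hB, hy.pair_eq_zero huv]
    have hval : s ≤ entrySum B := by
      have h1 : entrySum B = s⁻¹ * ∑ u, ∑ v, y {u, v} := by
        simp only [entrySum, hB, of_apply, mul_sum]
      have h2 := hy.sq_sum_le_sum_sum_pair
      rw [← hs] at h2
      rw [h1, le_inv_mul_iff₀ hs0]
      nlinarith [h2]
    exact hval.trans (le_csSup (bddAbove_thetaValues G) ⟨B, hfeas, rfl⟩)

end IsLasserreFeasible

/-- **`las⁽¹⁾(G) ≤ ϑ(G)`**. [cite: Laurent2006, §3.1, p. 248] -/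
theorem lasserreStableBound_one_le_lovaszTheta (G : SimpleGraph V) :
    lasserreStableBound G 1 ≤ lovaszTheta G :=
  lasserreStableBound_le_of_forall fun _ hy => hy.sum_singleton_le_lovaszTheta

/-! ### `ϑ(G) ≤ las⁽¹⁾(G)`: from trace-one matrices to moments -/

section ThetaToMoments

variable (B : Matrix V V ℝ)

/-- Row sums `b_v = Σ_w B_vw` (`= ⟨w_v, Σ_w w_w⟩` in Gram language). [folklore] -/
def rowSum (v : V) : ℝ := ∑ w, B v w

/-- The scalings `d_v = b_v / B_vv` (junk-free: `0` when `B_vv = 0`). [folklore] -/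
noncomputable def thetaScale (v : V) : ℝ := rowSum B v / B v v

/-- The level-1 moment vector attached to a trace-one matrix `B` with `s = Σ_{u,v} B_uv`:
`y_∅ = 1`, `y_{v} = s⁻¹ d_v B_vv d_v`, `y_{uv} = s⁻¹ d_u B_uv d_v`, and `0` on larger sets.
[folklore] -/
noncomputable def thetaToMoments (S : Finset V) : ℝ :=
  if S.card = 0 then 1
  else if S.card = 1 then (entrySum B)⁻¹ * ∑ v ∈ S, thetaScale B v * B v v * thetaScale B v
  else if S.card = 2 then
    (entrySum B)⁻¹ * (∑ u ∈ S, ∑ v ∈ S,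
      if u = v then 0 else thetaScale B u * B u v * thetaScale B v) / 2
  else 0

/-- The `V × P_1(V)` matrix `R` with columns `R_∅ = 𝟙` and `R_{v} = d_v e_v`. [folklore] -/
noncomputable def thetaToMomentsFactor : Matrix V {S : Finset V // S.card ≤ 1} ℝ :=
  Matrix.of fun w I => if I.1 = ∅ then 1 else if w ∈ I.1 then thetaScale B w else 0

/-- `y_∅ = 1`. [folklore] -/
@[simp] theorem thetaToMoments_empty : thetaToMoments B ∅ = 1 := by
  simp [thetaToMoments]

/-- `y_{v} = s⁻¹ d_v B_vv d_v`. [folklore] -/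
@[simp] theorem thetaToMoments_singleton (v : V) :
    thetaToMoments B {v} = (entrySum B)⁻¹ * (thetaScale B v * B v v * thetaScale B v) := by
  simp [thetaToMoments]

/-- `y_{uv} = s⁻¹ d_u B_uv d_v` for `u ≠ v` and symmetric `B`. [folklore] -/
theorem thetaToMoments_pair {u v : V} (huv : u ≠ v) (hsymm : B v u = B u v) :
    thetaToMoments B {u, v} = (entrySum B)⁻¹ * (thetaScale B u * B u v * thetaScale B v) := by
  have hcard : ({u, v} : Finset V).card = 2 := card_pair huv
  simp only [thetaToMoments, hcard, OfNat.ofNat_ne_zero, ↓reduceIte, OfNat.ofNat_ne_one]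
  rw [sum_pair huv, sum_pair huv, sum_pair huv]
  simp only [↓reduceIte, if_neg huv, if_neg (Ne.symm huv), hsymm]
  ring

/-- `R_{w,∅} = 1`. [folklore] -/
theorem thetaToMomentsFactor_apply_empty (w : V) (I : {S : Finset V // S.card ≤ 1})
    (hI : I.1 = ∅) : thetaToMomentsFactor B w I = 1 := by
  simp [thetaToMomentsFactor, hI]

/-- `R_{w,{v}} = d_v [w = v]`. [folklore] -/
theorem thetaToMomentsFactor_apply_singleton (w v : V) (I : {S : Finset V // S.card ≤ 1})
    (hI : I.1 = {v}) : thetaToMomentsFactor B w I = if w = v then thetaScale B v else 0 := by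
  simp only [thetaToMomentsFactor, of_apply, hI, singleton_ne_empty, ↓reduceIte, mem_singleton]
  split_ifs with h <;> simp [h]

variable {B}

/-- A zero diagonal entry of a positive semidefinite `B` has zero row sum. [folklore] -/
theorem rowSum_eq_zero_of_diag_eq_zero (hB : B.PosSemidef) {v : V} (hv : B v v = 0) :
    rowSum B v = 0 := by
  refine sum_eq_zero fun w _ => ?_
  have hsymm : B v w = B w v := by
    have h := hB.1.apply v w
    rw [star_trivial] at h
    exact h.symm
  rw [hsymm]
  exact psd_apply_eq_zero_of_diag_eq_zero hB hv w

omit [DecidableEq V] in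
/-- The key identity `d_v B_vv d_v = b_v d_v` (both vanish when `B_vv = 0`). [folklore] -/
theorem thetaScale_mul_diag_mul (v : V) :
    thetaScale B v * B v v * thetaScale B v = rowSum B v * thetaScale B v := by
  by_cases hv : B v v = 0
  · simp [thetaScale, hv]
  · simp only [thetaScale]
    field_simp

omit [DecidableEq V] in
/-- `b_v d_v = b_v² / B_vv`. [folklore] -/
theorem rowSum_mul_thetaScale (v : V) :
    rowSum B v * thetaScale B v = rowSum B v ^ 2 / B v v := by
  rw [thetaScale, pow_two, mul_div_assoc]

/-- **The moment matrix factors**: `M_1(y) = Rᵀ (s⁻¹ B) R` for the moments `y` attached to a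
positive semidefinite `B` (entrywise: `(∅,∅) ↦ s⁻¹ Σ B = 1`… for `s ≠ 0`; `(∅,{v}) ↦ s⁻¹ b_v d_v
= y_v`; `({u},{v}) ↦ s⁻¹ d_u B_uv d_v = y_{uv}`). [folklore] -/
theorem momentMatrix_thetaToMoments (hB : B.PosSemidef) (hs : entrySum B ≠ 0) :
    momentMatrix 1 (thetaToMoments B) =
      (thetaToMomentsFactor B)ᵀ * ((entrySum B)⁻¹ • B) * thetaToMomentsFactor B := by
  have hsymm : ∀ u v, B v u = B u v := fun u v => by
    have h := hB.1.apply u v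
    rwa [star_trivial] at h
  ext I J
  -- the right-hand entry as `s⁻¹ Σ_x (Σ_w R_{wI} B_{wx}) R_{xJ}`
  have hR : ((thetaToMomentsFactor B)ᵀ * ((entrySum B)⁻¹ • B) * thetaToMomentsFactor B) I J =
      (entrySum B)⁻¹ * ∑ x, (∑ w, thetaToMomentsFactor B w I * B w x) *
        thetaToMomentsFactor B x J := by
    simp only [Matrix.mul_apply, transpose_apply, Matrix.smul_apply, smul_eq_mul, Finset.mul_sum,
      Finset.sum_mul]
    exact sum_congr rfl fun x _ => sum_congr rfl fun w _ => by ring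
  rw [hR, momentMatrix_apply]
  rcases levelOne_cases I with hI | ⟨u, hu⟩ <;> rcases levelOne_cases J with hJ | ⟨v, hv⟩
  · -- `(∅, ∅)`: `1 = s⁻¹ Σ_{x,w} B_{wx}`
    simp only [hI, hJ, union_empty, thetaToMoments_empty, thetaToMomentsFactor_apply_empty B _ _ hI,
      thetaToMomentsFactor_apply_empty B _ _ hJ, one_mul, mul_one]
    rw [sum_comm]
    exact (inv_mul_cancel₀ hs).symm
  · -- `(∅, {v})`: `y_v = s⁻¹ b_v d_v`
    simp only [hI, hv, empty_union, thetaToMoments_singleton,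
      thetaToMomentsFactor_apply_empty B _ _ hI, thetaToMomentsFactor_apply_singleton B _ _ _ hv,
      one_mul, mul_ite, mul_zero, Finset.sum_ite_eq', mem_univ, if_true]
    rw [thetaScale_mul_diag_mul, rowSum]
    congr 2
    exact sum_congr rfl fun w _ => hsymm w v
  · -- `({u}, ∅)`: `y_u = s⁻¹ d_u b_u`
    simp only [hu, hJ, union_empty, thetaToMoments_singleton,
      thetaToMomentsFactor_apply_empty B _ _ hJ, thetaToMomentsFactor_apply_singleton B _ _ _ hu,
      mul_one, ite_mul, zero_mul, Finset.sum_ite_eq', mem_univ, if_true]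
    rw [thetaScale_mul_diag_mul, rowSum, mul_comm (∑ w, B u w) _, Finset.mul_sum]
  · -- `({u}, {v})`: `y_{uv} = s⁻¹ d_u B_{uv} d_v`
    simp only [hu, hv, thetaToMomentsFactor_apply_singleton B _ _ _ hu,
      thetaToMomentsFactor_apply_singleton B _ _ _ hv, ite_mul, zero_mul, mul_ite, mul_zero,
      Finset.sum_ite_eq', mem_univ, if_true]
    by_cases huv : u = v
    · subst huv
      rw [← insert_eq, pair_eq_singleton, thetaToMoments_singleton]
    · rw [← insert_eq, thetaToMoments_pair B huv (hsymm u v)]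

/-- **`ϑ(G) ≤ las⁽¹⁾(G)`, pointwise**: the value `Σ_{u,v} B_uv` of every theta-feasible `B` is at
most `las⁽¹⁾(G)` (the moments `thetaToMoments B` are level-1 feasible with value
`s⁻¹ Σ_v b_v² / B_vv ≥ s` by Cauchy–Schwarz). [cite: Laurent2006, §3.1, p. 248] -/
theorem IsThetaFeasible.entrySum_le_lasserreStableBound_one {G : SimpleGraph V}
    (hB : IsThetaFeasible G B) : entrySum B ≤ lasserreStableBound G 1 := by
  set s := entrySum B with hs
  rcases le_or_gt s 0 with hs0 | hs0
  · exact hs0.trans (lasserreStableBound_nonneg G 1 le_rfl)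
  · have hsymm : ∀ u v, B v u = B u v := fun u v => by
      have h := hB.posSemidef.1.apply u v
      rwa [star_trivial] at h
    -- feasibility of the attached moments
    have hfeas : IsLasserreFeasible G 1 (thetaToMoments B) := by
      refine ⟨thetaToMoments_empty B, fun u v huv => ?_, ?_⟩
      · rw [thetaToMoments_pair B huv.ne (hsymm u v), hB.apply_eq_zero huv]
        simp
      · rw [momentMatrix_thetaToMoments hB.posSemidef hs0.ne']
        have h := (hB.posSemidef.smul (inv_nonneg.2 hs0.le)).conjTranspose_mul_mul_same
          (thetaToMomentsFactor B)
        rwa [conjTranspose_eq_transpose_of_trivial] at h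
    -- the value
    have hval : s ≤ ∑ v, thetaToMoments B {v} := by
      have h1 : ∑ v, thetaToMoments B {v} = s⁻¹ * ∑ v, rowSum B v ^ 2 / B v v := by
        simp only [thetaToMoments_singleton, thetaScale_mul_diag_mul, rowSum_mul_thetaScale,
          ← mul_sum, hs]
      -- Cauchy–Schwarz: `(Σ b_v)² ≤ (Σ b_v²/B_vv) (Σ B_vv)` with `Σ B_vv = Tr B = 1`, `Σ b_v = s`
      have hCS := sum_sq_le_sum_mul_sum_of_sq_le_mul (univ : Finset V) (r := rowSum B)
        (f := fun v => rowSum B v ^ 2 / B v v) (g := fun v => B v v)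
        (fun v _ => div_nonneg (sq_nonneg _) hB.posSemidef.diag_nonneg)
        (fun v _ => hB.posSemidef.diag_nonneg)
        (fun v _ => by
          by_cases hv : B v v = 0
          · rw [rowSum_eq_zero_of_diag_eq_zero hB.posSemidef hv, hv]
            simp
          · rw [div_mul_cancel₀ _ hv])
      have htr : ∑ v, B v v = 1 := by
        have := hB.trace_eq_one
        rwa [Matrix.trace] at this
      have hsum : ∑ v, rowSum B v = s := rfl
      rw [htr, mul_one, hsum] at hCS
      rw [h1, le_inv_mul_iff₀ hs0]
      nlinarith [hCS]
    exact hval.trans (hfeas.sum_singleton_le_lasserreStableBound le_rfl)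

end ThetaToMoments

/-- **`ϑ(G) ≤ las⁽¹⁾(G)`**. [cite: Laurent2006, §3.1, p. 248] -/
theorem lovaszTheta_le_lasserreStableBound_one (G : SimpleGraph V) :
    lovaszTheta G ≤ lasserreStableBound G 1 := by
  by_cases hne : ({B | IsThetaFeasible G B} : Set (Matrix V V ℝ)).Nonempty
  · exact csSup_le (hne.image _)
      (by rintro _ ⟨B, hB, rfl⟩; exact hB.entrySum_le_lasserreStableBound_one)
  · rw [Set.not_nonempty_iff_eq_empty] at hne
    rw [lovaszTheta, hne, Set.image_empty, Real.sSup_empty]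
    exact lasserreStableBound_nonneg G 1 le_rfl

/-- **Level one of Lasserre's hierarchy is the Lovász number**: `las⁽¹⁾(G) = ϑ(G)`
(Laurent 2006, p. 248: "For `k = 1`, `las⁽¹⁾(G) = ϑ(G)`"; the equality of the moment form (1),
p. 240, with the trace-one form of `ϑ`, Lovász 1979 / Knuth 1994 `ϑ₃`).
[cite: Laurent2006, §3.1, p. 248] -/
theorem lasserreStableBound_one_eq_lovaszTheta (G : SimpleGraph V) :
    lasserreStableBound G 1 = lovaszTheta G :=
  le_antisymm (lasserreStableBound_one_le_lovaszTheta G) (lovaszTheta_le_lasserreStableBound_one G)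

/-- Hence every level is at most `ϑ`: `las⁽ᵗ⁾(G) ≤ ϑ(G)` for `t ≥ 1`. [cite: Laurent2006, §3.1, p. 248] -/
theorem lasserreStableBound_le_lovaszTheta (G : SimpleGraph V) {t : ℕ} (ht : 1 ≤ t) :
    lasserreStableBound G t ≤ lovaszTheta G :=
  (lasserreStableBound_anti_level le_rfl ht).trans (lasserreStableBound_one_le_lovaszTheta G)

end Literature.Combinatorics.SimpleGraph
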